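import Summits.QuantumFields.YangMills.Theorems.BalabanUVNodesK0AxCauchyDecoupling

/-!
# NODE O — LENS-1 «cauchy-analytic» g12 — LOCALITY HALF of the decoupling expansion (companion 2 of `nodeO-cover/LENS-1-NODE-v13p1.md`, node item N2):
# «a mixed first difference of a SUM OF COMPONENT FUNCTIONS vanishes as soon as every component ignores one of the differenced parameters»

LANDING NOTE (porter ▶ PTC-1 g4, 2026-08-31; AUTHORSHIP = ◇ lens-1 g12 «cauchy-analytic», HOME sketch `nodeO-cover/LENS-1g12-CauchyDecouplingLocality-v1.lean` sha16 cb089283b4dd8bf8 · 142 l. · 12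
thm + 1 generic def (`IndepOf`) · 0 sorry (CANDIDATE 11: the model-free LOCALITY half of [II] (1.9)–(1.10) — componentwise-independent finite sums have `Δ_l = 0`, so the decoupling expansion runs
over the surviving subsets only; companion of ✓p824330 `…K0AxCauchyDecoupling`)): landed VERBATIM (only this paragraph added) under the basename ◇ proposed
(`…Theorems/BalabanUVNodesK0AxCauchyDecouplingLocality.lean`, same ns `…Theorems.K0AxCauchyDecoupling`) as INTENT-73; one import ✓p824330; `--supports stmt-QuantumFields-27930 --as helper` (NO
`--workitem`; kind definition by the `def` rule); ◆ CRIT-1 g38's cut (nodeO STATUS 2026-08-31T13:40:46Z): «(c) CUT CANDIDATE 11 → GO VERBATIM; 12 thm ∕ 1 def, every decl docstringed, cite first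
tokens bib keys; axioms standard on 7 guarded names; J4: 12 × 0, `IndepOf` exists only under other FQNs; J1′∕J5′: `IndepOf` a GENERIC predicate with parameters, non-junk; SAME-WALL: SURVIVES,
priced as an S-size bookkeeping ADDENDUM (A = N2a kernel-checked; B = N2b the MODEL letter + N4 + N1 + N7 = all of Bałaban's content, NOT in the tree)».  HONEST (porter): finite differences ∕
`Function.update` ∕ list-filter bookkeeping, kernel-checked — proves NOTHING of Bałaban; ⟨27930⟩ `stub_FE` ∕ FE-2 OPEN; K0ᴬ stmt-QuantumFields-27238 OPEN; NODE O 0∕1; COUNT 8∕28 · K 1∕4 UNMOVED;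
finite 𝕋⁴ at fixed ε — NOT continuum ∕ OS ∕ Clay; the Yang–Mills mass gap is NOT proved by any of this.

Cell `ym-nodeO-ideate`, LENS IDEATOR seat `ymgap-nodeO-lens-1-g12` (count-neutral).  Builds on the landed brick
✓ `Summits/QuantumFields/YangMills/Theorems/BalabanUVNodesK0AxCauchyDecoupling.lean` (p824330: `decDiff`, `decDiffList`, `setOn`, `decoupling_expansion`).

WHY.  In [Balaban1988RG2Cluster] (1.9)–(1.10) p.4 the expansion in the decoupling parameters `s(□)` is a sum over subsets `σ`; the
term of `σ` is the mixed derivative ∕ difference in the variables of `σ` at `s = 0` off `σ`.  With `s = 0` off `σ` the expression SEPARATES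
over the connected components of `Y(σ) = □₄ ∪ ⋃σ` — verbatim p.4: *"Thus Eq. (1.4) represents a system of separated equations in components
of Y(σ) … If there are other components, then the derivatives with respect to s restricted to these components render the term equal to 0.
This simplifies the sum in (1.9). We can write it as a sum over connected domains Y₀ containing □₄"* — i.e. the bracket is a SUM of functions
each depending only on the parameters of ONE component, and a mixed first difference in ALL variables of `σ` kills every summand that ignores
one of them.  THIS FILE is the model-free half of that step:
* `IndepOf y G` — `G` does not depend on the coordinate `y`; `decDiff_eq_zero_of_indepOf`, `indepOf_decDiff`, `indepOf_decDiffList`;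
* ★ `decDiffList_eq_zero_of_indepOf` — if `G` ignores some `y ∈ l` then `Δ_l G = 0` (no `Nodup` needed);
* linearity `decDiff_add` ∕ `decDiffList_add` ∕ `decDiffList_finset_sum` (and `decDiffList_zero`);
* ★★ `decDiffList_sum_eq_zero_of_componentwise` — a finite sum of component functions, each ignoring SOME variable of `l`, has `Δ_l = 0`;
* ★★ `decoupling_expansion_filter` — hence in `decoupling_expansion` only the subsets `Z` passing any predicate `P` with «`¬P Z` ⇒ the term
  vanishes» survive: `F (setOn l 1 s) = (((l.sublists').filter P).map fun Z => decDiffList Z F (setOn l 0 s)).sum` (print: `P Z` = «`□₄ ∪ ⋃Z`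
  connected», and then `Z = Y₀ ∖ □₄` is determined by `Y₀`).
HONEST FRAMING.  Elementary algebra of finite differences, kernel-checked; the MODEL statement (that the record's s-weakened fluctuation bracket with
`s = 0` off `σ` is such a componentwise sum — N2 of the node) is NOT here and is print's [II] p.4; nothing of Bałaban is asserted, ported or
discharged; `stub_FE` ∕ `stub_P0C` ∕ `stub_G3C` OPEN; 27930 OPEN; K0ᴬ ∕ NODE O 0∕1; finite tori at fixed ε — NOT continuum ∕ OS;
**the Yang–Mills mass gap (Clay) is NOT proved by any of this.**  No `sorry`, no `instance`, no `notation`; one `def`; standard axioms.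
-/

noncomputable section

open Function

namespace Summit.QuantumFields.YangMills.Theorems.K0AxCauchyDecoupling

variable {ι : Type*} [DecidableEq ι]

/-! ## §1  Independence of a coordinate and vanishing of differences -/

/-- `G` does not depend on the coordinate `y`. [cite: Balaban1988RG2Cluster, (1.9)–(1.10) p.4 (the separated components; locator)] -/
def IndepOf (y : ι) (G : (ι → ℂ) → ℂ) : Prop := ∀ (s : ι → ℂ) (t : ℂ), G (update s y t) = G s

/-- A difference in an ignored coordinate vanishes. [cite: Balaban1988RG2Cluster, (1.9)–(1.10) p.4 «render the term equal to 0»] -/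
theorem decDiff_eq_zero_of_indepOf {y : ι} {G : (ι → ℂ) → ℂ} (h : IndepOf y G) : decDiff y G = 0 := by
  funext s
  simp [decDiff, h s 1, h s 0]

/-- Differencing in another coordinate preserves independence of `y` (bookkeeping: `update` commutes on distinct coordinates). -/
theorem indepOf_decDiff {y y' : ι} {G : (ι → ℂ) → ℂ} (h : IndepOf y G) (hne : y ≠ y') : IndepOf y (decDiff y' G) := by
  intro s t
  simp only [decDiff]
  rw [update_comm hne, update_comm hne, h, h]

/-- Iterated differencing off `y` preserves independence of `y` (bookkeeping). -/
theorem indepOf_decDiffList {y : ι} {G : (ι → ℂ) → ℂ} (h : IndepOf y G) :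
    ∀ {l : List ι}, y ∉ l → IndepOf y (decDiffList l G)
  | [], _ => by simpa using h
  | y' :: l, hy => by
      have hne : y ≠ y' := fun e => hy (List.mem_cons.mpr (Or.inl e))
      have hl : y ∉ l := fun e => hy (List.mem_cons_of_mem y' e)
      simpa [decDiffList] using indepOf_decDiff (indepOf_decDiffList h hl) hne

/-- `Δ 0 = 0` (bookkeeping). -/
@[simp] theorem decDiff_zero (y : ι) : decDiff y (0 : (ι → ℂ) → ℂ) = 0 := by
  funext s; simp [decDiff]

/-- `Δ_l 0 = 0` (bookkeeping). -/
@[simp] theorem decDiffList_zero : ∀ l : List ι, decDiffList l (0 : (ι → ℂ) → ℂ) = 0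
  | [] => rfl
  | y :: l => by simp [decDiffList, decDiffList_zero l]

/-- ★ **If `G` ignores some differenced parameter, the mixed first difference vanishes** — no `Nodup` hypothesis needed.
[cite: Balaban1988RG2Cluster, (1.9)–(1.10) p.4 «the derivatives with respect to s restricted to these components render the term equal to 0»] -/
theorem decDiffList_eq_zero_of_indepOf {y : ι} {G : (ι → ℂ) → ℂ} (h : IndepOf y G) :
    ∀ {l : List ι}, y ∈ l → decDiffList l G = 0
  | [], hy => by simp at hy
  | y' :: l, hy => by
      by_cases hyl : y ∈ l
      · simp [decDiffList, decDiffList_eq_zero_of_indepOf h hyl]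
      · have hyy' : y = y' := by
          rcases List.mem_cons.mp hy with h' | h'
          · exact h'
          · exact absurd h' hyl
        subst hyy'
        simpa [decDiffList] using decDiff_eq_zero_of_indepOf (indepOf_decDiffList h hyl)

/-! ## §2  Linearity -/

/-- `Δ_y (G + H) = Δ_y G + Δ_y H` (bookkeeping). -/
theorem decDiff_add (y : ι) (G H : (ι → ℂ) → ℂ) : decDiff y (G + H) = decDiff y G + decDiff y H := by
  funext s; simp [decDiff]; ring

/-- `Δ_l (G + H) = Δ_l G + Δ_l H` (bookkeeping). -/
theorem decDiffList_add (G H : (ι → ℂ) → ℂ) : ∀ l : List ι, decDiffList l (G + H) = decDiffList l G + decDiffList l H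
  | [] => by simp
  | y :: l => by simp [decDiffList, decDiffList_add G H l, decDiff_add]

/-- `Δ_l` of a finite sum is the sum of the `Δ_l` (bookkeeping). -/
theorem decDiffList_finset_sum {C : Type*} (S : Finset C) (G : C → (ι → ℂ) → ℂ) (l : List ι) :
    decDiffList l (∑ c ∈ S, G c) = ∑ c ∈ S, decDiffList l (G c) := by
  classical
  induction S using Finset.induction_on with
  | empty => simp
  | insert a S ha ih => rw [Finset.sum_insert ha, Finset.sum_insert ha, decDiffList_add, ih]

/-! ## §3  The locality step and the filtered decoupling expansion -/

/-- ★★ **LOCALITY**: a finite sum of «component» functions, EACH ignoring SOME parameter of `l`, has vanishing mixed first difference along `l`.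
This is the abstract content of [II] p.4: with `s = 0` off `σ` the bracket separates over the connected components of `Y(σ)`, and unless ONE
component carries all of `σ` the term of `σ` is `0`. [cite: Balaban1988RG2Cluster, (1.9)–(1.10) p.4] -/
theorem decDiffList_sum_eq_zero_of_componentwise {C : Type*} (S : Finset C) (G : C → (ι → ℂ) → ℂ) {l : List ι}
    (h : ∀ c ∈ S, ∃ y ∈ l, IndepOf y (G c)) :
    decDiffList l (∑ c ∈ S, G c) = 0 := by
  rw [decDiffList_finset_sum]
  refine Finset.sum_eq_zero fun c hc => ?_
  obtain ⟨y, hy, hG⟩ := h c hc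
  exact decDiffList_eq_zero_of_indepOf hG hy

omit [DecidableEq ι] in
/-- Dropping the vanishing terms of a list sum (bookkeeping for `decoupling_expansion_filter`). -/
theorem sum_map_filter_of_vanishing (f : List ι → ℂ) (P : List ι → Prop) [DecidablePred P] :
    ∀ L : List (List ι), (∀ Z ∈ L, ¬ P Z → f Z = 0) → (L.map f).sum = ((L.filter P).map f).sum
  | [], _ => by simp
  | Z :: L, h => by
      have hL : ∀ Z' ∈ L, ¬ P Z' → f Z' = 0 := fun Z' hZ' => h Z' (List.mem_cons_of_mem Z hZ')
      by_cases hZ : P Z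
      · simp [hZ, sum_map_filter_of_vanishing f P L hL]
      · simp [hZ, h Z List.mem_cons_self hZ, sum_map_filter_of_vanishing f P L hL]

/-- ★★ **THE FILTERED DECOUPLING EXPANSION**: if the terms of the subsets failing a (decidable) predicate `P` vanish, the expansion of ✓`decoupling_expansion`
runs over the subsets satisfying `P` only — print's «sum over connected domains Y₀ containing □₄» ([II] (1.10)).
[cite: Balaban1988RG2Cluster, (1.10) p.4–5] -/
theorem decoupling_expansion_filter (F : (ι → ℂ) → ℂ) {l : List ι} (hl : l.Nodup) (s : ι → ℂ)
    (P : List ι → Prop) [DecidablePred P]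
    (hP : ∀ Z ∈ l.sublists', ¬ P Z → decDiffList Z F (setOn l 0 s) = 0) :
    F (setOn l 1 s) = (((l.sublists').filter P).map fun Z => decDiffList Z F (setOn l 0 s)).sum := by
  rw [decoupling_expansion F l hl s]
  exact sum_map_filter_of_vanishing _ P _ hP

end Summit.QuantumFields.YangMills.Theorems.K0AxCauchyDecoupling

end
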